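import Literature.AnabelianGeometry.EtaleTheta.TowerOfSetting
import Literature.AnabelianGeometry.EtaleTheta.Discharge.Sec2GalExtensionCocycles

/-!
# [EtTh] Cor 2.16 for the §1 model, I: pointwise lemmas (`l·Δ_Θ`-valued cocycles on `Π^tp_Ÿ̲̲`, their
# reductions mod `M`, and conjugation by geometric elements of `Π^tp_X̲̲`)

Mochizuki, *The Étale Theta Function and its Frobenioid-theoretic Manifestations* [EtTh],
Publ. RIMS 45 (2009), §2, Prop 2.14 (iii) p.50, Cor 2.16 pp.53–54, over the §1 setting (Prop 1.5, p.23)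
(locators `p.N` = PDF pages of the PRIMS text; bib key `MochizukiEtTh2009`). PROOF-ONLY companion (no
`def`; seat abc-iut-L2-t2, node `EtTh:Cor2.16` for the §1 model) of `ThetaEnvOfSetting.lean` /
`TowerOfSetting.lean` (seat abc-iut-L2-t8: the model tower `DoubleUnderline.thetaEnvTower`, whose mod-`M`
theta cocycles are the reductions `modN` of the `l·Δ_Θ`-valued root cocycles `rootCocycles`, p.46).

Pointwise bookkeeping used by `Discharge/Sec2Cor216OfModel.lean`:

* `conjNormal_toTheta_conj_of_aug_eq_one` — for GEOMETRIC `x` (`aug x = 1`), the coboundary `∂c` of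
  `c ∈ Δ_Θ` takes the same value at `k` and at `x⁻¹ k x` (`Δ_Θ` is central in `(Δ^tp_X)^Θ`, p.12);
* `CyclotomeMod.red_cob` — the reduction mod `N` of a `Δ_Θ`-coboundary value `k̄ b k̄⁻¹ b⁻¹` with
  `b ∈ l·Δ_Θ` is the `μ_N`-coboundary value `(aug k · red b) · (red b)⁻¹` (`G_K`-equivariance of
  `(l·Δ_Θ) ↠ μ_N`, "the natural isomorphism", p.46);
* `CyclotomeMod.red_cob_eq_sq_mul` — **the parity trick**: for `l` ODD ([IUTchI] Rmk 3.1.6) and ANY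
  `b ∈ Δ_Θ` whose coboundary value `∂b(k)` lies in `l·Δ_Θ`, the reduction of `∂b(k)` is a SQUARE times a
  `μ_N`-coboundary value (`∂b = (∂b^{(l+1)/2})² · (∂(b^l))⁻¹` and `b^l ∈ l·Δ_Θ`) — the `l·Δ_Θ`-lift
  ambiguity of a `Δ_Θ`-class is the Kummer class of an element of `μ_l`, a square;
* `DoubleUnderline.conjCocycle_modN_apply` — conjugating the reduction of a root cocycle `f` by a
  geometric `x ∈ Π^tp_X̲̲` is reducing `k ↦ f(x⁻¹ k x)` (`galMuN (aug x) = 1`);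
* `DoubleUnderline.exists_geometric_generator` — a generator of `Gal(Y̲̲/X̲̲) ≅ ℤ` inside `Δ^tp_X̲̲`
  (`Π^tp_Ÿ̲̲ ↠ G_K`, `map_aug_Ydduu`).

HONEST FRAMING: bookkeeping over abc-iut-L2-t1/t8's data; nothing asserted; no side taken on
[IUTchIII] Cor 3.12.
-/

noncomputable section

namespace Literature.AnabelianGeometry.EtaleTheta

open Literature.AnabelianGeometry.SemiGraphs
open scoped IsMulCommutative

namespace ThetaSetting

variable {p : ℕ} [Fact p.Prime] {D : ThetaSetting p}

/-! ## Coboundary values of `Δ_Θ` under geometric conjugation -/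

/-- For geometric `x` (`aug x = 1`): `∂c(x⁻¹ k x) = ∂c(k)`, i.e. conjugation of `c ∈ Δ_Θ` by the image of
`x⁻¹ k x` equals conjugation by the image of `k` (`x̄^{±1}` centralise `Δ_Θ`, p.12).
[cite: MochizukiEtTh2009, §1 p.12] -/
theorem conjNormal_toTheta_conj_of_aug_eq_one {x : D.PiTemp} (hx : D.aug.toMonoidHom x = 1)
    (k : D.PiTemp) (c : D.DeltaTheta) :
    MulAut.conjNormal (D.toTheta (x⁻¹ * k * x)) c = MulAut.conjNormal (D.toTheta k) c := by
  have hx' : D.aug.toMonoidHom x⁻¹ = 1 := by rw [map_inv, hx, inv_one]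
  rw [map_mul D.toTheta, map_mul D.toTheta, map_mul, map_mul, MulAut.mul_apply, MulAut.mul_apply,
    conjNormal_eq_of_aug_eq_one hx, conjNormal_eq_of_aug_eq_one hx']

/-- Powers of a `Δ_Θ`-coboundary value: `(k̄ b k̄⁻¹ b⁻¹)^n = k̄ bⁿ k̄⁻¹ b⁻ⁿ` (`Δ_Θ` commutative).
[cite: MochizukiEtTh2009, §1 p.12] -/
theorem cob_pow (t : D.GtpTheta) (b : D.DeltaTheta) (n : ℕ) :
    (MulAut.conjNormal t b * b⁻¹) ^ n = MulAut.conjNormal t (b ^ n) * (b ^ n)⁻¹ := by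
  rw [mul_pow, map_pow, inv_pow]

/-- Integer powers of a `Δ_Θ`-coboundary value. [cite: MochizukiEtTh2009, §1 p.12] -/
theorem cob_zpow (t : D.GtpTheta) (b : D.DeltaTheta) (n : ℤ) :
    (MulAut.conjNormal t b * b⁻¹) ^ n = MulAut.conjNormal t (b ^ n) * (b ^ n)⁻¹ := by
  rw [mul_zpow, map_zpow, inv_zpow]

/-- `b^l ∈ l·Δ_Θ` for `b ∈ Δ_Θ` (definition of `l·Δ_Θ`). [cite: MochizukiEtTh2009, Prop 2.12 (i) p.45] -/
theorem coe_pow_mem_lDeltaTheta (l : ℕ) (b : D.DeltaTheta) :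
    ((b ^ l : D.DeltaTheta) : D.GtpTheta) ∈ D.lDeltaTheta l :=
  ⟨(b : D.GtpTheta), b.2, by rw [Subgroup.coe_pow]⟩

/-- `(b^l)^n`-shaped memberships: `(b^n)^l ∈ l·Δ_Θ`. [cite: MochizukiEtTh2009, Prop 2.12 (i) p.45] -/
theorem coe_pow_pow_mem_lDeltaTheta (l n : ℕ) (b : D.DeltaTheta) :
    ((b ^ (n * l) : D.DeltaTheta) : D.GtpTheta) ∈ D.lDeltaTheta l := by
  rw [pow_mul]
  exact coe_pow_mem_lDeltaTheta l (b ^ n)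

namespace CyclotomeMod

variable {l : ℕ} {N : ℕ+} (μ : D.CyclotomeMod l N)

/-- **Reduction of a `Δ_Θ`-coboundary value**: for `b ∈ l·Δ_Θ` and `k ∈ Π^tp_X`,
`red(k̄ b k̄⁻¹ b⁻¹) = (aug k · red b) · (red b)⁻¹` (`G_K`-equivariance of `(l·Δ_Θ) ↠ μ_N`, p.46).
[cite: MochizukiEtTh2009, Def 2.13 p.46] -/
theorem red_cob (k : D.PiTemp) (b : D.DeltaTheta) (hb : (b : D.GtpTheta) ∈ D.lDeltaTheta l)
    (h : ((MulAut.conjNormal (D.toTheta k) b * b⁻¹ : D.DeltaTheta) : D.GtpTheta) ∈ D.lDeltaTheta l) :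
    μ.red ⟨_, h⟩ = galMuN p N (D.aug.toMonoidHom k) (μ.red ⟨b, hb⟩) * (μ.red ⟨b, hb⟩)⁻¹ := by
  rw [← μ.red_conj, ← map_inv μ.red, ← map_mul μ.red]
  congr 1

/-- **The parity trick** (`l` odd): for ANY `b ∈ Δ_Θ` whose coboundary value `∂b(k) = k̄ b k̄⁻¹ b⁻¹` lies
in `l·Δ_Θ`, its reduction mod `N` is the SQUARE of the reduction of `∂b(k)^{(l+1)/2}` times the inverse of
the `μ_N`-coboundary value of `red(b^l)` at `k` — because `∂b(k) = (∂b(k)^{(l+1)/2})² · (∂(b^l)(k))⁻¹` and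
`b^l ∈ l·Δ_Θ`. (The lift ambiguity `b mod l·Δ_Θ ∈ Δ_Θ/l·Δ_Θ ≅ μ_l` reduces to a Kummer class of `μ_l`,
which consists of squares as `l` is odd.) [cite: MochizukiEtTh2009, Cor 2.16 p.53] -/
theorem red_cob_eq_sq_mul (hl : Odd l) (k : D.PiTemp) (b : D.DeltaTheta)
    (h : ((MulAut.conjNormal (D.toTheta k) b * b⁻¹ : D.DeltaTheta) : D.GtpTheta) ∈ D.lDeltaTheta l) :
    μ.red ⟨_, h⟩ =
      μ.red ⟨(((MulAut.conjNormal (D.toTheta k) b * b⁻¹) ^ ((l + 1) / 2) : D.DeltaTheta) : D.GtpTheta),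
          by rw [Subgroup.coe_pow]; exact pow_mem h _⟩ ^ 2 *
        (galMuN p N (D.aug.toMonoidHom k) (μ.red ⟨_, coe_pow_mem_lDeltaTheta l b⟩) *
          (μ.red ⟨_, coe_pow_mem_lDeltaTheta l b⟩)⁻¹)⁻¹ := by
  obtain ⟨m, hm⟩ := hl
  have hml : (l + 1) / 2 = m + 1 := by omega
  have hpow : ((MulAut.conjNormal (D.toTheta k) b * b⁻¹) ^ ((l + 1) / 2)) ^ 2 =
      (MulAut.conjNormal (D.toTheta k) b * b⁻¹) * (MulAut.conjNormal (D.toTheta k) b * b⁻¹) ^ l := by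
    rw [← pow_mul, hml, show (m + 1) * 2 = l + 1 by omega, pow_succ']
  -- the `l`-th power is the coboundary value of `b^l ∈ l·Δ_Θ`
  have hl' : ((((MulAut.conjNormal (D.toTheta k) b * b⁻¹) ^ l : D.DeltaTheta)) : D.GtpTheta) ∈
      D.lDeltaTheta l := by rw [Subgroup.coe_pow]; exact pow_mem h _
  have hredl : μ.red ⟨_, hl'⟩ = galMuN p N (D.aug.toMonoidHom k) (μ.red ⟨_, coe_pow_mem_lDeltaTheta l b⟩) *
      (μ.red ⟨_, coe_pow_mem_lDeltaTheta l b⟩)⁻¹ := by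
    rw [← μ.red_cob k (b ^ l) (coe_pow_mem_lDeltaTheta l b) (by rw [← cob_pow]; exact hl')]
    congr 2
    rw [cob_pow]
  rw [← hredl, ← map_pow μ.red, ← map_inv μ.red, ← map_mul μ.red]
  congr 1
  apply Subtype.ext
  change ((MulAut.conjNormal (D.toTheta k) b * b⁻¹ : D.DeltaTheta) : D.GtpTheta) =
    ((((MulAut.conjNormal (D.toTheta k) b * b⁻¹) ^ ((l + 1) / 2) : D.DeltaTheta) :
      D.GtpTheta)) ^ 2 * ((((MulAut.conjNormal (D.toTheta k) b * b⁻¹) ^ l : D.DeltaTheta)) :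
        D.GtpTheta)⁻¹
  rw [← Subgroup.coe_pow, ← Subgroup.coe_inv, ← Subgroup.coe_mul, hpow, mul_inv_cancel_right]

end CyclotomeMod

namespace EtaleThetaData.DoubleUnderline

variable {E : D.EtaleThetaData} {l : ℕ} (C : E.DoubleUnderline l) {Es : Set ℕ+}
  (τ : D.CyclotomeTower l Es)

/-! ## The model tower: conjugating reductions of root cocycles -/

/-- For `x ∈ Π^tp_X̲̲` and `k ∈ Π^tp_Ÿ̲̲`: the conjugate `x⁻¹ k x` as an element of `Π^tp_Ÿ̲̲` (bookkeeping
between the two copies of `Π^tp_Ÿ̲̲`). [cite: MochizukiEtTh2009, Def 2.13 p.46] -/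
theorem coe_inclYdduu_conj (x : C.Huu) (g : D.GtpYdd.subgroupOf C.Huu)
    (hg : x⁻¹ * (g : C.Huu) * x ∈ D.GtpYdd.subgroupOf C.Huu) :
    (C.inclYdduu ⟨x⁻¹ * (g : C.Huu) * x, hg⟩ : D.PiTemp) = (x : D.PiTemp)⁻¹ * (C.inclYdduu g : D.PiTemp) * x :=
  rfl

/-- **Conjugating the reduction of a root cocycle by a GEOMETRIC element**: for `x ∈ Π^tp_X̲̲` with
`aug x = 1` and an `l·Δ_Θ`-valued cocycle `f` on `Π^tp_Ÿ̲̲`, `(x · red∘f)(k) = red(f(x⁻¹ k x))` (the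
character factor `galMuN (aug x)` is trivial). [cite: MochizukiEtTh2009, Cor 2.16 p.54] -/
theorem conjCocycle_modN_apply (hC : D.Compat) (hS : D.Sec2Hyps) (M : Es)
    (f : contCocycles D.toTheta D.DeltaTheta C.GtpYdduu) (hf : ∀ g, (f.1 g : D.GtpTheta) ∈ D.lDeltaTheta l)
    (x : C.Huu) (hx : D.aug.toMonoidHom (x : D.PiTemp) = 1) (g : D.GtpYdd.subgroupOf C.Huu) :
    (C.thetaEnvTower τ hC hS).conjCocycle M x (C.modN (τ.mod M) f hf) g =
      (τ.mod M).red ⟨f.1 ⟨(x : D.PiTemp)⁻¹ * (C.inclYdduu g : D.PiTemp) * x,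
        C.inv_mul_mul_mem_GtpYdduu hC x (C.inclYdduu g)⟩, hf _⟩ := by
  have hχ : (C.thetaEnvTower τ hC hS).chi M ((C.thetaEnvTower τ hC hS).aug x) = 1 := by
    change galMuN p M (D.aug.toMonoidHom ((x : C.Huu) : D.PiTemp)) = 1
    rw [hx, map_one]
  change (C.thetaEnvTower τ hC hS).chi M ((C.thetaEnvTower τ hC hS).aug x) (C.modN (τ.mod M) f hf _) = _
  rw [hχ, MulAut.one_apply]
  rfl

/-- **A geometric generator of `Gal(Y̲̲/X̲̲)`**: there is `x ∈ Π^tp_X̲̲` generating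
`Π^tp_X̲̲/Π^tp_Y̲̲ ≅ ℤ` with `aug x = 1` (lift a generator and correct it by an element of `Π^tp_Ÿ̲̲` with
the inverse Galois image, `Π^tp_Ÿ̲̲ ↠ G_K` by `map_aug_Ydduu`). [cite: MochizukiEtTh2009, Prop 2.2 (iii) p.37] -/
theorem exists_geometric_generator (hC : D.Compat) (hS : D.Sec2Hyps) :
    ∃ x : C.Huu, (C.thetaEnvTower τ hC hS).galYX (QuotientGroup.mk x) = Multiplicative.ofAdd (1 : ℤ) ∧
      (C.thetaEnvTower τ hC hS).aug x = 1 ∧ D.aug.toMonoidHom (x : D.PiTemp) = 1 := by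
  set T := C.thetaEnvTower τ hC hS with hT
  haveI : T.PiY.Normal := T.PiY_normal
  obtain ⟨q, hq⟩ := QuotientGroup.mk_surjective (T.galYX.symm (Multiplicative.ofAdd (1 : ℤ)))
  have hy : (((T.aug q)⁻¹ : D.GK) : GQp p) ∈ (D.GtpYdd ⊓ C.Huu).map D.aug.toMonoidHom := by
    rw [C.map_aug_Ydduu]; exact ((T.aug q)⁻¹).2
  obtain ⟨y, hymem, hyq⟩ := hy
  refine ⟨q * ⟨y, (Subgroup.mem_inf.1 hymem).2⟩, ?_, ?_, ?_⟩
  · have hyY : (⟨y, (Subgroup.mem_inf.1 hymem).2⟩ : C.Huu) ∈ T.PiY :=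
      T.PiYdd_le (Subgroup.mem_subgroupOf.2 (Subgroup.mem_inf.1 hymem).1)
    rw [QuotientGroup.mk_mul, (QuotientGroup.eq_one_iff _).mpr hyY, mul_one, hq,
      MulEquiv.apply_symm_apply]
  · apply Subtype.ext
    change D.aug.toMonoidHom ((q : D.PiTemp) * y) = ((1 : D.GK) : GQp p)
    rw [map_mul, hyq, OneMemClass.coe_one, Subgroup.coe_inv]
    exact mul_inv_cancel _
  · change D.aug.toMonoidHom ((q : D.PiTemp) * y) = 1
    rw [map_mul, hyq, Subgroup.coe_inv]
    exact mul_inv_cancel _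

end EtaleThetaData.DoubleUnderline

end ThetaSetting

end Literature.AnabelianGeometry.EtaleTheta

end
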